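import Summits.CriticalPhenomena.PercolationContinuityZ3.Theorems.Transplant.GrigorchukSuperpolynomialGrowth
import Literature.Probability.Percolation.CoveringTameFibres
import HarnessLib

/-!
# No polynomial bound on ANY Cayley graph of the first Grigorchuk group (change of finite generating set)

builds on p205010 (kernel theorem, internal audit signed; external expert review pending) — nothing in this file uses p205010; growth only, no `θ(p_c)`
statement, no node touched.  Lane `prim-bschramm`, seat `prim-bschramm-gen-1` gen 8 (GEN pen; offer O-GR2, the 'every S' transfer the refuter asked for in
#7990 (5)).  Helper file (`--supports stmt-CriticalPhenomena-4575 --as helper`).  Def-free; class rows only — no `@[conjecture]` declared, edited or claimed.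
WORD DISCIPLINE as in «GrigorchukSuperpolynomialGrowth» (p618494): the polynomial-growth node's HYPOTHESIS fails on every `Cay(𝔊; S)` — the node 'does not apply'
there, nothing about its truth; NO growth exponent typed.

THE TRANSFER (the other direction from G4 p613200): for a finite GENERATING `S ⊆ 𝔊` each letter `a, b, c, d` is joined to `1` in `Cay(𝔊; S)` by a walk of length
`≤ W` (connectedness), left multiplications are automorphisms («CayleySkeletonSign» `leftMulIso`), so a word of `n` letters is a walk of `≤ W·n` edges:
`wordBall n ⊆ B_S(1, W n)`, whence a bound `C·(n+1)^D` on the balls of `Cay(𝔊; S)` would give the bound `(C (W+1)^{max D 0})·(n+1)^{max D 0}` on the balls of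
`Cay(𝔊; a,b,c,d)` (all vertices, by `ballVolume_map_eq`) — contradicting p618494:
**`not_polynomialGrowth_cayley_gens (S) (hS : closure S = ⊤) : ¬ ∃ C D : ℝ, ∀ x n, (ballVolume (Cay(𝔊; S)) x n : ℝ) ≤ C·(n+1)^D`.**
[cite: Grigorchuk1984, Thm. (intermediate growth, independence of the generating set)] [cite: LyonsPeres2016, §7.2 (word metrics of two finite generating sets are bi-Lipschitz)]
-/

noncomputable section

namespace Summit.CriticalPhenomena.PercolationContinuityZ3.Theorems.Transplant

namespace Grigorchuk

open SimpleGraph Literature.Barriers.CriticalPhenomena Literature.Probability.Percolation Literature.Probability.LatticeModels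
open scoped Classical

/-- In a Cayley graph of `𝔊` on a generating set every letter is within a uniform distance `W` of `1`, from every vertex: `u · ℓ ∈ B_S(u, W)`.
[cite: LyonsPeres2016, §7.2] -/
theorem exists_letter_walk_bound (S : Finset ↥grigorchukGroup) (hS : Subgroup.closure (↑S : Set ↥grigorchukGroup) = ⊤) :
    ∃ W : ℕ, ∀ (u : ↥grigorchukGroup) (ℓ : Letter), u * ℓ.toG ∈ graphBall (mulCayley (↑S : Set ↥grigorchukGroup)) u W := by
  have hc := CayleyScaled.connected_mulCayley_of_closure S hS
  have h1 : ∀ ℓ : Letter, ∃ n : ℕ, ℓ.toG ∈ graphBall (mulCayley (↑S : Set ↥grigorchukGroup)) 1 n := by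
    intro ℓ
    obtain ⟨p⟩ := hc.preconnected 1 ℓ.toG
    exact ⟨p.length, p, le_rfl⟩
  choose f hf using h1
  refine ⟨f .a + f (.x .b) + f (.x .c) + f (.x .d), fun u ℓ => ?_⟩
  have hℓ : f ℓ ≤ f .a + f (.x .b) + f (.x .c) + f (.x .d) := by rcases ℓ with _ | ⟨_ | _ | _⟩ <;> omega
  have h := mem_graphBall_map (leftMulIso S u) (hf ℓ)
  rw [leftMulIso_apply, leftMulIso_apply, mul_one] at h
  exact graphBall_mono _ u hℓ h

/-- **`wordBall n ⊆ B_S(1, W·n)`**: a word of `n` letters is a walk of `≤ W n` edges in `Cay(𝔊; S)`. [cite: LyonsPeres2016, §7.2] -/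
theorem wordBall_subset_graphBall_gens (S : Finset ↥grigorchukGroup) (hS : Subgroup.closure (↑S : Set ↥grigorchukGroup) = ⊤) :
    ∃ W : ℕ, ∀ n : ℕ, (↑(wordBall n) : Set ↥grigorchukGroup) ⊆ graphBall (mulCayley (↑S : Set ↥grigorchukGroup)) 1 (W * n) := by
  obtain ⟨W, hW⟩ := exists_letter_walk_bound S hS
  refine ⟨W, fun n g hg => ?_⟩
  rw [Finset.mem_coe, mem_wordBall] at hg
  obtain ⟨w, hw, rfl⟩ := hg
  -- a word of length `k` read from `u` stays within distance `W k`
  have key : ∀ (w : List Letter) (u : ↥grigorchukGroup), u * (w.map Letter.toG).prod ∈ graphBall (mulCayley (↑S : Set ↥grigorchukGroup)) u (W * w.length) := by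
    intro w
    induction w with
    | nil => intro u; rw [List.map_nil, List.prod_nil, mul_one]; exact mem_graphBall_self _ u _
    | cons ℓ w ih =>
      intro u
      have h1 := hW u ℓ
      have h2 := ih (u * ℓ.toG)
      rw [List.map_cons, List.prod_cons, ← mul_assoc, List.length_cons, Nat.mul_succ, add_comm]
      obtain ⟨p1, hp1⟩ := h1
      obtain ⟨p2, hp2⟩ := h2
      exact ⟨p1.append p2, by rw [SimpleGraph.Walk.length_append]; omega⟩
  have h := key w 1
  rw [one_mul] at h
  exact graphBall_mono _ 1 (Nat.mul_le_mul_left W hw) h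

/-- **NO POLYNOMIAL BOUND ON ANY CAYLEY GRAPH OF `𝔊`**: for every finite generating set `S`, `Cay(𝔊; S)` admits no bound `|B(x, n)| ≤ C·(n+1)^D` — the growth
hypothesis of `BenjaminiSchramm1996_conj4_polynomialGrowth` fails there (with G4 p613200: no exponential rate either — intermediate growth on every Cayley graph,
kernel; no exponent typed). [cite: Grigorchuk1984, Thm. (intermediate growth)] [cite: LyonsPeres2016, §7.2] -/
theorem not_polynomialGrowth_cayley_gens (S : Finset ↥grigorchukGroup) (hS : Subgroup.closure (↑S : Set ↥grigorchukGroup) = ⊤) :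
    ¬ ∃ C D : ℝ, ∀ (x : ↥grigorchukGroup) (n : ℕ), (ballVolume (mulCayley (↑S : Set ↥grigorchukGroup)) x n : ℝ) ≤ C * ((n : ℝ) + 1) ^ D := by
  rintro ⟨C, D, hCD⟩
  obtain ⟨W, hW⟩ := wordBall_subset_graphBall_gens S hS
  apply not_polynomialGrowth_cayley
  -- the standard Cayley graph inherits the bound `C (W+1)^D' (n+1)^D'` with `D' = max D 0`
  set D' : ℝ := max D 0 with hD'
  refine ⟨max C 0 * ((W : ℝ) + 1) ^ D', D', fun x n => ?_⟩
  -- all vertices of the standard Cayley graph have the same ball volumes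
  have hx : ballVolume (mulCayley (↑({aG, bG, cG, dG} : Finset ↥grigorchukGroup) : Set ↥grigorchukGroup)) x n =
      ballVolume (mulCayley (↑({aG, bG, cG, dG} : Finset ↥grigorchukGroup) : Set ↥grigorchukGroup)) 1 n := by
    have h := ballVolume_map_eq (leftMulIso ({aG, bG, cG, dG} : Finset ↥grigorchukGroup) x) 1 n
    rwa [leftMulIso_apply, mul_one] at h
  rw [hx, ballVolume_eq_card_wordBall]
  -- `|wordBall n| ≤ |B_S(1, W n)| ≤ C (W n + 1)^D ≤ C⁺ (W+1)^D' (n+1)^D'`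
  have hfin := graphBall_finite (mulCayley (↑S : Set ↥grigorchukGroup)) 1 (W * n)
  have h1 : ((wordBall n).card : ℝ) ≤ (ballVolume (mulCayley (↑S : Set ↥grigorchukGroup)) 1 (W * n) : ℝ) := by
    have := Set.ncard_le_ncard (hW n) hfin
    rw [Set.ncard_coe_finset] at this
    exact_mod_cast this
  have h2 := hCD 1 (W * n)
  have hWn0 : (1 : ℝ) ≤ ((W * n : ℕ) : ℝ) + 1 := by have := (Nat.cast_nonneg (W * n) : (0 : ℝ) ≤ _); linarith
  have hn1 : (1 : ℝ) ≤ (n : ℝ) + 1 := by have := (Nat.cast_nonneg n : (0 : ℝ) ≤ _); linarith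
  have hW1 : (1 : ℝ) ≤ (W : ℝ) + 1 := by have := (Nat.cast_nonneg W : (0 : ℝ) ≤ _); linarith
  have hD'0 : 0 ≤ D' := le_max_right _ _
  have hC : C ≤ max C 0 := le_max_left _ _
  have hpos : (0 : ℝ) ≤ (((W * n : ℕ) : ℝ) + 1) ^ D := Real.rpow_nonneg (by linarith) D
  -- `(W n + 1)^D ≤ (W n + 1)^D' ≤ ((W+1)(n+1))^D' = (W+1)^D' (n+1)^D'`
  have h3 : (((W * n : ℕ) : ℝ) + 1) ^ D ≤ (((W * n : ℕ) : ℝ) + 1) ^ D' := Real.rpow_le_rpow_of_exponent_le hWn0 (le_max_left _ _)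
  have h4 : (((W * n : ℕ) : ℝ) + 1) ^ D' ≤ (((W : ℝ) + 1) * ((n : ℝ) + 1)) ^ D' := by
    refine Real.rpow_le_rpow (by linarith) ?_ hD'0
    push_cast; nlinarith [Nat.cast_nonneg (α := ℝ) W, Nat.cast_nonneg (α := ℝ) n]
  rw [Real.mul_rpow (by linarith) (by linarith)] at h4
  calc ((wordBall n).card : ℝ) ≤ C * (((W * n : ℕ) : ℝ) + 1) ^ D := h1.trans h2
    _ ≤ max C 0 * (((W * n : ℕ) : ℝ) + 1) ^ D := mul_le_mul_of_nonneg_right hC hpos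
    _ ≤ max C 0 * (((W : ℝ) + 1) ^ D' * ((n : ℝ) + 1) ^ D') := mul_le_mul_of_nonneg_left (h3.trans h4) (le_max_right _ _)
    _ = max C 0 * ((W : ℝ) + 1) ^ D' * ((n : ℝ) + 1) ^ D' := by ring

end Grigorchuk

end Summit.CriticalPhenomena.PercolationContinuityZ3.Theorems.Transplant

end
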